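import Summits.BirchSwinnertonDyer.BirchSwinnertonDyer.Theorems.KolyvaginDepthDoorDepthTableKuriharaDecisivePair
import Summits.BirchSwinnertonDyer.BirchSwinnertonDyer.Theorems.KolyvaginDepthDoorDepthTableKuriharaDecisivePairBridge
import HarnessLib

/-!
# Route `KolyvaginDepthDoor`, crux `KolyvaginDepthSupplyKN` (stmt-BirchSwinnertonDyer-22820) —
# DEPTH TABLE v23, GENERIC: «THE DECISIVE TUPLE AT DEPTH `r = rank`» — the E-SIDE of a rank-`r` row TWO-WAY AT A
# PRESCRIBED cyclic Kolyvagin level `n = ℓ₁⋯ℓ_r` («`Ш(E/ℚ)[p] = 0 ⟺ δ̃_n(E)` is a unit»), granted a KERNEL certificate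
# that the localisation matrix of `r` rational points at `(ℓ₁, …, ℓ_r)` is invertible mod `p`; the RANK-THREE form
# (the `p² + p + 1` projective representatives) and the KERNEL BRIDGE for a triple combination `a•P₁ + b•P₂ + c•P₃`

Helper file of the lead prover of line `levelone` (kdd-p1 g27; `--supports stmt-BirchSwinnertonDyer-22820
--as helper`); it closes nothing and BSD is NOT proved by it.

WHY. v22 (g26, `…KuriharaDecisivePair`) made the E-side of every RANK-TWO row two-way at the recorded depth-two
level. The route's thesis is «depth = rank − 1» for Kolyvagin's classes, i.e. «`ν(n) = rank`» in the Kurihara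
currency, at EVERY rank; the named input `Sakamoto2022_kuriharaNumber_ne_zero_of_localizationInjective` (Sakamoto
2022 Lemma 4.4 + Lemma 4.6 (1) + Remark 4.5, ITERATED) is already stated at depth `r`. v23 draws the rank-`r`
consequence and instantiates it at `r = 3`, where the tree holds `129` depth-three records on `97` rank-three
curves (`112` of them on `85` curves with a kernel `rank = 3` certificate of KERNEL-2DESC-CL) — the first
E-side readings BEYOND the rank-two table (g26's footnote on `5077a1` was numerics only). Per-curve sequel:
`…KuriharaDecisiveTriple5077a1` (`p = 7`, `n = 113·211·463`, the generators `(1,0), (2,0), (0,2)`).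

CONTENTS. §1 `kuriharaClaim_of_natCard_selmerGroup_le_pow` / `sha_inf_torsionBy_eq_bot_iff_kuriharaClaim_of_rank`:
at `rank_ℤ E(ℚ) = r`, «`Ш(E/ℚ)[p] = 0` ⟺ the claim at the prescribed depth-`r` level» given `r` points whose
non-trivial `𝔽_p`-combinations are each `p`-indivisible in some `E(ℚ_{ℓ_j})` (`⟹` the named input with
`#Sel_p = p^{rank}`; `⟸` v17 / Kim Thm. 1.11). §2 `localNondivisible_transport₃`, `localWitness₃_of_representatives`
(pure group theory): the `p³ − 1` combinations from the `p² + p + 1` projective representatives `(0,0,1)`, `(0,1,t)`,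
`(1,s,t)`. §3 `isCyclicKolyvaginLevel_of_three` (the level binder for three Kolyvagin primes from point counts). The
sibling file `…KuriharaDecisiveTriple` carries the KERNEL BRIDGE for `a•P₁ + b•P₂ + c•P₃` and the rank-three E-side
two-way theorem `sha_inf_torsionBy_eq_bot_iff_kuriharaClaim_triple` at a prescribed `n = ℓ₁ℓ₂ℓ₃`.

CONDITIONAL on the named facts displayed as hypotheses (`hSakR`; `hKim`, `hnf`, `hMaz` for `⟸`); per
`(W, p, ℓ₁, …, ℓ_r)`; nothing class-wide (the open stub (S♭) is untouched); BSD is NOT proved by any of this.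

References: [Sakamoto2022pSelmer] Doc. Math. 27 (2022) = arXiv:2106.03370, Lemma 4.4, Rem. 4.5, Lemma 4.6 (1), Thm. 4.8;
[Kurihara2014] arXiv:1407.2465, Thm. 1.2.3 (1), §5.3 example (8); [Kim2022StructureSelmer] Thm. 1.11, §1.2.2;
[SilvermanAEC2009] III.2.3, VII.2.1, VII.3.1, VIII.2, X.4.2.
-/

set_option linter.dupNamespace false

noncomputable section

open scoped Classical NumberField

namespace Summit.BirchSwinnertonDyer.BirchSwinnertonDyer.Theorems.KolyvaginDepthDoor

open Literature.NumberTheory.EllipticCurves Literature.NumberTheory.EllipticCurves.ModularForms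
  WeierstrassCurve NumberField IsDedekindDomain
open Summit.BirchSwinnertonDyer.BirchSwinnertonDyer.Theorems
open Summit.BirchSwinnertonDyer.BirchSwinnertonDyer.Rank2Observatory

/-! ## §1 Generic depth `r = rank`: the E-side two-way at a prescribed cyclic level -/

/-- **THE DECISIVE TUPLE (E-side form, depth `r`): a unit mod-`p` Kurihara number AT THE PRESCRIBED LEVEL `n`,
`ν(n) = r`.** `W` globally minimal; `p ≥ 5` good ordinary, `ρ̄_{E,p}` onto, `a_p ≢ 1`, `p ∤ ord_v(Δ_min)` at
multiplicative `v` (Kodaira–Néron, so `p ∤ Tam(E)`); `#Sel_p(E/ℚ) ≤ p^r`; `n` a cyclic Kolyvagin level with `r` prime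
factors; `P : Fin r → E(ℚ)` with every combination `∑ aᵢ Pᵢ`, `(aᵢ) ≢ 0 (mod p)`, `p`-indivisible in `E(ℚ_ℓ)` for some
`ℓ ∣ n`. THEN every datum `D` with `p ∤ c_D` and the period transfer carries a unit Kurihara number AT `n` — the named
input `hSakR` with its two arithmetic side conditions (`p ∤ #Ẽ(𝔽_p)`, `p ∤ Tam`) discharged from `a_p ≢ 1` and
Kodaira–Néron. CONDITIONAL on `hSakR`; BSD is not proved by it.
[cite: Sakamoto2022pSelmer, Lemma 4.4, Remark 4.5, Lemma 4.6 (1) (p. 14)] [cite: SilvermanAEC2009, VII.3 Prop. 3.1] -/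
theorem kuriharaClaim_of_natCard_selmerGroup_le_pow
    (hSakR : Literature.NumberTheory.EllipticCurves.Sakamoto2022_kuriharaNumber_ne_zero_of_localizationInjective)
    (W : WeierstrassCurve ℚ) [W.IsElliptic] [W.IsGloballyMinimal] (p : ℕ) [hp : Fact p.Prime] (h5 : 5 ≤ p)
    (hgood : W.HasGoodReductionAtPrime p) (hord : ¬ (p : ℤ) ∣ W.frobeniusTrace p)
    (hsur : W.HasSurjectiveModNGaloisRep p) (hna : ¬ (p : ℤ) ∣ W.frobeniusTrace p - 1)
    (hKN : ∀ v : HeightOneSpectrum (𝓞 ℚ), W.HasMultiplicativeReductionAt v → ¬ p ∣ W.ordMinimalDiscriminant v)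
    (r : ℕ) (hle : Nat.card (W.selmerGroup p) ≤ p ^ r)
    (n : ℕ) [NeZero n] (hn : IsCyclicKolyvaginLevel W p n) (hcard : n.primeFactors.card = r)
    (P : Fin r → W.toAffine.Point)
    (hloc : ∀ a : Fin r → ℕ, (∃ i, ¬ p ∣ a i) →
      ∃ (ℓ : ℕ) (_ : Fact ℓ.Prime), ℓ ∈ n.primeFactors ∧
        ∀ Q : (W.baseChange ℚ_[ℓ]).toAffine.Point,
          p • Q ≠ ∑ i, a i •
            WeierstrassCurve.Affine.Point.map (W' := W.toAffine) (S := ℚ) (Algebra.ofId ℚ ℚ_[ℓ]) (P i))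
    {N : ℕ} [NeZero N] (D : ModularParametrizationData W N) (hc : ¬ (p : ℤ) ∣ D.maninConstant)
    (hu : ∃ u : ℚ, ‖(u : ℚ_[p])‖ = 1 ∧ W.realPeriodRat = u * plusPeriod D.f) :
    ∃ ψ : (q : ℕ) → (ZMod q)ˣ →* Multiplicative (ZMod p),
      (∀ q ∈ n.primeFactors, Function.Surjective (ψ q)) ∧ kuriharaNumber D.f p n ψ ≠ 0 := by
  have htam : ¬ p ∣ W.tamagawaProduct := not_dvd_tamagawaProduct_of_kodairaNeron W p h5 hKN
  have hnap : ¬ p ∣ W.reductionPointCount p := fun h ↦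
    hna ((dvd_reductionPointCount_iff_dvd_frobeniusTrace_sub_one W p).mp h)
  exact hSakR W p h5 ⟨hgood, hord⟩ hsur hnap htam D hc hu r hle n hn hcard P hloc

/-- **E-SIDE, EXACTLY, AT THE PRESCRIBED DEPTH-`r` LEVEL: at `rank_ℤ E(ℚ) = r`, `Ш(E/ℚ)[p] = 0` ⟺ a unit mod-`p`
Kurihara number of `E` AT THE LEVEL `n` (`ν(n) = r`, for every admissible datum)**, granted the kernel certificate
that every non-trivial `𝔽_p`-combination of `r` given rational points is `p`-indivisible in some `E(ℚ_ℓ)`, `ℓ ∣ n`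
(«the localisation matrix at `(ℓ₁, …, ℓ_r)` is invertible»; the points are then a basis of `E(ℚ)/p`). `⟸`: v17
(Kim Thm. 1.11, depth `r ≤ rank`); `⟹`: `Ш(E)[p] = 0` and `E(ℚ)[p] = 0` give `#Sel_p(E) = p^r` and §1 applies. The
rank-two case is v22's `sha_inf_torsionBy_eq_bot_iff_kuriharaClaim_pair`. CONDITIONAL on `hKim`, `hnf`, `hMaz`,
`hSakR`; per curve; BSD is not proved by it. [cite: Sakamoto2022pSelmer, Lemma 4.4, Lemma 4.6 (1)]
[cite: Kim2022StructureSelmer, Thm. 1.11] [cite: SilvermanAEC2009, Thm. X.4.2] -/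
theorem sha_inf_torsionBy_eq_bot_iff_kuriharaClaim_of_rank
    (hKim : Kim2022_card_selmerGroup_le_pow_of_kuriharaNumber_ne_zero) (hnf : exists_isNewformOf)
    (hMaz : mazur_not_dvd_maninConstant_of_odd)
    (hSakR : Literature.NumberTheory.EllipticCurves.Sakamoto2022_kuriharaNumber_ne_zero_of_localizationInjective)
    (W : WeierstrassCurve ℚ) [W.IsElliptic] [W.IsGloballyMinimal] (p : ℕ) [hp : Fact p.Prime] (h5 : 5 ≤ p)
    (hgood : W.HasGoodReductionAtPrime p) (hord : ¬ (p : ℤ) ∣ W.frobeniusTrace p)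
    (hsur : W.HasSurjectiveModNGaloisRep p) (hna : ¬ (p : ℤ) ∣ W.frobeniusTrace p - 1)
    (hKN : ∀ v : HeightOneSpectrum (𝓞 ℚ), W.HasMultiplicativeReductionAt v → ¬ p ∣ W.ordMinimalDiscriminant v)
    [iNZ : NeZero (W.conductorNorm ℤ)] (r : ℕ) (hrank : W.mordellWeilRank = r)
    (n : ℕ) [NeZero n] (hn : IsCyclicKolyvaginLevel W p n) (hcard : n.primeFactors.card = r)
    (P : Fin r → W.toAffine.Point)
    (hloc : ∀ a : Fin r → ℕ, (∃ i, ¬ p ∣ a i) →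
      ∃ (ℓ : ℕ) (_ : Fact ℓ.Prime), ℓ ∈ n.primeFactors ∧
        ∀ Q : (W.baseChange ℚ_[ℓ]).toAffine.Point,
          p • Q ≠ ∑ i, a i •
            WeierstrassCurve.Affine.Point.map (W' := W.toAffine) (S := ℚ) (Algebra.ofId ℚ ℚ_[ℓ]) (P i)) :
    (W.sha ⊓ AddSubgroup.torsionBy W.galH1 (p : ℤ) : AddSubgroup W.galH1) = ⊥ ↔
      ∀ (D : ModularParametrizationData W (W.conductorNorm ℤ)), ¬ (p : ℤ) ∣ D.maninConstant →
        (∃ u : ℚ, ‖(u : ℚ_[p])‖ = 1 ∧ W.realPeriodRat = u * plusPeriod D.f) →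
        ∃ ψ : (q : ℕ) → (ZMod q)ˣ →* Multiplicative (ZMod p),
          (∀ q ∈ n.primeFactors, Function.Surjective (ψ q)) ∧ kuriharaNumber D.f p n ψ ≠ 0 := by
  constructor
  · intro hsha D hc hu
    have hirr : W.HasIrreducibleModPGaloisRep p := hasIrreducibleModPGaloisRep_of_hasSurjectiveModNGaloisRep W p hsur
    have hle : Nat.card (W.selmerGroup p) ≤ p ^ r := by
      rw [natCard_selmerGroup_eq_pow_rank_of_sha_inf_torsionBy_eq_bot W p hirr hsha, hrank]
    exact kuriharaClaim_of_natCard_selmerGroup_le_pow hSakR W p h5 hgood hord hsur hna hKN r hle n hn hcard P hloc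
      D hc hu
  · intro hδ
    exact sha_inf_torsionBy_eq_bot_of_kuriharaClaim hKim hnf hMaz W p h5 hgood hord hsur hna hKN n hn
      (by rw [hcard, hrank]) hδ

/-! ## §2 Depth three: the reduction to the `p² + p + 1` projective representatives (pure group theory) -/

/-- Transport of local `p`-divisibility along `u • (a•z₁ + b•z₂ + c•z₃) = (a'•z₁ + b'•z₂ + c'•z₃) + p • (…)`:
if `u a = a' + p v`, `u b = b' + p w`, `u c = c' + p w'` and `a'•z₁ + b'•z₂ + c'•z₃` is NOT `p`-divisible, neither is
`a•z₁ + b•z₂ + c•z₃`. [folklore] -/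
theorem localNondivisible_transport₃ {G : Type*} [AddCommGroup G] (p : ℕ) (z₁ z₂ z₃ : G)
    (a b c a' b' c' u v w w' : ℕ) (hua : u * a = a' + p * v) (hub : u * b = b' + p * w)
    (huc : u * c = c' + p * w')
    (h : ∀ Q : G, p • Q ≠ a' • z₁ + b' • z₂ + c' • z₃) : ∀ Q : G, p • Q ≠ a • z₁ + b • z₂ + c • z₃ := by
  intro Q hQ
  refine h (u • Q - v • z₁ - w • z₂ - w' • z₃) ?_
  have e : p • (u • Q - v • z₁ - w • z₂ - w' • z₃) =
      u • (p • Q) - (p * v) • z₁ - (p * w) • z₂ - (p * w') • z₃ := by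
    rw [smul_sub, smul_sub, smul_sub, smul_smul p v, smul_smul p w, smul_smul p w', smul_comm p u Q]
  rw [e, hQ, smul_add, smul_add, smul_smul u a, smul_smul u b, smul_smul u c, hua, hub, huc, add_smul, add_smul,
    add_smul]
  abel

/-- A modular inverse in `ℕ`: for `p` prime and `p ∤ c` there are `u, v` with `u * c = 1 + p * v`. [folklore] -/
theorem exists_mul_eq_one_add_mul_of_not_dvd (p : ℕ) [hp : Fact p.Prime] (c : ℕ) (hc : ¬ p ∣ c) :
    ∃ u v : ℕ, u * c = 1 + p * v := by
  have hpP : p.Prime := hp.out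
  have hc0 : (c : ZMod p) ≠ 0 := by
    rwa [Ne, ZMod.natCast_eq_zero_iff]
  refine ⟨((c : ZMod p)⁻¹).val, ((c : ZMod p)⁻¹).val * c / p, ?_⟩
  have h1 : ((((c : ZMod p)⁻¹).val * c : ℕ) : ZMod p) = ((1 : ℕ) : ZMod p) := by
    rw [Nat.cast_mul, ZMod.natCast_zmod_val, inv_mul_cancel₀ hc0, Nat.cast_one]
  have h2 := (ZMod.natCast_eq_natCast_iff' _ _ _).mp h1
  rw [Nat.mod_eq_of_lt hpP.one_lt] at h2
  have h3 := Nat.div_add_mod (((c : ZMod p)⁻¹).val * c) p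
  omega

/-- **From the `p² + p + 1` projective representatives to all `p³ − 1` combinations** (three additive groups —
`E(ℚ_{ℓ₁})`, `E(ℚ_{ℓ₂})`, `E(ℚ_{ℓ₃})` —, three elements in each): if `P₃`, `P₂`, `P₁`, every `P₂ + t•P₃`, `P₁ + s•P₂`,
`P₁ + t•P₃` and `P₁ + s•P₂ + t•P₃` (`1 ≤ s, t < p`) is not `p`-divisible in one of the three groups, so is every
`a•P₁ + b•P₂ + c•P₃` with `(a, b, c) ≢ (0, 0, 0) (mod p)` (multiply by an inverse of the first coefficient prime
to `p`) — «the `3 × 3` localisation matrix is invertible» read off its projective rows. [folklore] -/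
theorem localWitness₃_of_representatives {G₁ G₂ G₃ : Type*} [AddCommGroup G₁] [AddCommGroup G₂] [AddCommGroup G₃]
    (p : ℕ) [hp : Fact p.Prime] (x₁ y₁ z₁ : G₁) (x₂ y₂ z₂ : G₂) (x₃ y₃ z₃ : G₃)
    (h001 : (∀ Q : G₁, p • Q ≠ z₁) ∨ (∀ Q : G₂, p • Q ≠ z₂) ∨ (∀ Q : G₃, p • Q ≠ z₃))
    (h010 : (∀ Q : G₁, p • Q ≠ y₁) ∨ (∀ Q : G₂, p • Q ≠ y₂) ∨ (∀ Q : G₃, p • Q ≠ y₃))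
    (h100 : (∀ Q : G₁, p • Q ≠ x₁) ∨ (∀ Q : G₂, p • Q ≠ x₂) ∨ (∀ Q : G₃, p • Q ≠ x₃))
    (h01t : ∀ t, 1 ≤ t → t < p →
      (∀ Q : G₁, p • Q ≠ 1 • y₁ + t • z₁) ∨ (∀ Q : G₂, p • Q ≠ 1 • y₂ + t • z₂) ∨
        (∀ Q : G₃, p • Q ≠ 1 • y₃ + t • z₃))
    (h1s0 : ∀ s, 1 ≤ s → s < p →
      (∀ Q : G₁, p • Q ≠ 1 • x₁ + s • y₁) ∨ (∀ Q : G₂, p • Q ≠ 1 • x₂ + s • y₂) ∨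
        (∀ Q : G₃, p • Q ≠ 1 • x₃ + s • y₃))
    (h10t : ∀ t, 1 ≤ t → t < p →
      (∀ Q : G₁, p • Q ≠ 1 • x₁ + t • z₁) ∨ (∀ Q : G₂, p • Q ≠ 1 • x₂ + t • z₂) ∨
        (∀ Q : G₃, p • Q ≠ 1 • x₃ + t • z₃))
    (h1st : ∀ s t, 1 ≤ s → s < p → 1 ≤ t → t < p →
      (∀ Q : G₁, p • Q ≠ 1 • x₁ + s • y₁ + t • z₁) ∨ (∀ Q : G₂, p • Q ≠ 1 • x₂ + s • y₂ + t • z₂) ∨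
        (∀ Q : G₃, p • Q ≠ 1 • x₃ + s • y₃ + t • z₃)) :
    ∀ a b c : ℕ, ¬ (p ∣ a ∧ p ∣ b ∧ p ∣ c) →
      (∀ Q : G₁, p • Q ≠ a • x₁ + b • y₁ + c • z₁) ∨ (∀ Q : G₂, p • Q ≠ a • x₂ + b • y₂ + c • z₂) ∨
        (∀ Q : G₃, p • Q ≠ a • x₃ + b • y₃ + c • z₃) := by
  have hpP : p.Prime := hp.out
  -- the residue `t < p` of `u * c` and its quotient
  have hres : ∀ u c : ℕ, ∃ t w : ℕ, t < p ∧ u * c = t + p * w := fun u c ↦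
    ⟨u * c % p, u * c / p, Nat.mod_lt _ hpP.pos, by have := Nat.div_add_mod (u * c) p; omega⟩
  -- transport of a three-way disjunction
  have htr : ∀ (a b c a' b' c' u v w w' : ℕ), u * a = a' + p * v → u * b = b' + p * w → u * c = c' + p * w' →
      ((∀ Q : G₁, p • Q ≠ a' • x₁ + b' • y₁ + c' • z₁) ∨ (∀ Q : G₂, p • Q ≠ a' • x₂ + b' • y₂ + c' • z₂) ∨
        (∀ Q : G₃, p • Q ≠ a' • x₃ + b' • y₃ + c' • z₃)) →
      (∀ Q : G₁, p • Q ≠ a • x₁ + b • y₁ + c • z₁) ∨ (∀ Q : G₂, p • Q ≠ a • x₂ + b • y₂ + c • z₂) ∨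
        (∀ Q : G₃, p • Q ≠ a • x₃ + b • y₃ + c • z₃) := by
    intro a b c a' b' c' u v w w' hua hub huc h
    rcases h with h | h | h
    · exact Or.inl (localNondivisible_transport₃ p x₁ y₁ z₁ a b c a' b' c' u v w w' hua hub huc h)
    · exact Or.inr (Or.inl (localNondivisible_transport₃ p x₂ y₂ z₂ a b c a' b' c' u v w w' hua hub huc h))
    · exact Or.inr (Or.inr (localNondivisible_transport₃ p x₃ y₃ z₃ a b c a' b' c' u v w w' hua hub huc h))
  intro a b c habc
  by_cases ha : p ∣ a
  · obtain ⟨a₀, rfl⟩ := ha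
    by_cases hb : p ∣ b
    · -- `p ∣ a`, `p ∣ b`, so `p ∤ c`: the representative `(0, 0, 1)`
      obtain ⟨b₀, rfl⟩ := hb
      have hc : ¬ p ∣ c := fun h ↦ habc ⟨dvd_mul_right _ _, dvd_mul_right _ _, h⟩
      obtain ⟨u, v, huv⟩ := exists_mul_eq_one_add_mul_of_not_dvd p c hc
      refine htr (p * a₀) (p * b₀) c 0 0 1 u (u * a₀) (u * b₀) v (by ring) (by ring) huv ?_
      simpa only [zero_smul, one_smul, zero_add] using h001
    · -- `p ∣ a`, `p ∤ b`: the representatives `(0, 1, t)`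
      obtain ⟨u, w, huw⟩ := exists_mul_eq_one_add_mul_of_not_dvd p b hb
      obtain ⟨t, w', htp, huc⟩ := hres u c
      by_cases ht0 : t = 0
      · subst ht0
        refine htr (p * a₀) b c 0 1 0 u (u * a₀) w w' (by ring) huw huc ?_
        simpa only [zero_smul, one_smul, zero_add, add_zero] using h010
      · refine htr (p * a₀) b c 0 1 t u (u * a₀) w w' (by ring) huw huc ?_
        simpa only [zero_smul, zero_add] using h01t t (Nat.one_le_iff_ne_zero.mpr ht0) htp
  · -- `p ∤ a`: the representatives `(1, s, t)`
    obtain ⟨u, v, huv⟩ := exists_mul_eq_one_add_mul_of_not_dvd p a ha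
    obtain ⟨s, w, hsp, hub⟩ := hres u b
    obtain ⟨t, w', htp, huc⟩ := hres u c
    by_cases hs0 : s = 0
    · subst hs0
      by_cases ht0 : t = 0
      · subst ht0
        refine htr a b c 1 0 0 u v w w' huv hub huc ?_
        simpa only [zero_smul, one_smul, add_zero] using h100
      · refine htr a b c 1 0 t u v w w' huv hub huc ?_
        simpa only [zero_smul, add_zero] using h10t t (Nat.one_le_iff_ne_zero.mpr ht0) htp
    · by_cases ht0 : t = 0
      · subst ht0
        refine htr a b c 1 s 0 u v w w' huv hub huc ?_
        simpa only [zero_smul, add_zero] using h1s0 s (Nat.one_le_iff_ne_zero.mpr hs0) hsp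
      · exact htr a b c 1 s t u v w w' huv hub huc
          (h1st s t (Nat.one_le_iff_ne_zero.mpr hs0) hsp (Nat.one_le_iff_ne_zero.mpr ht0) htp)

/-! ## §3 The cyclic Kolyvagin level of three primes -/

/-- **`ℓ₁ℓ₂ℓ₃` is a cyclic Kolyvagin level** from three (pairwise distinct) Kolyvagin primes of level one whose
`p`-parts of `#Ẽ(𝔽_{ℓᵢ})` are cyclic (`#Ẽ(𝔽_ℓ)[p] ≤ p` for `ℓ ∣ n`). [cite: Kim2022StructureSelmer, §1.2.2 (PDF p. 5)] -/
theorem isCyclicKolyvaginLevel_of_three (W : WeierstrassCurve ℚ) [W.IsGloballyMinimal] (p : ℕ)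
    {ℓ₁ ℓ₂ ℓ₃ n : ℕ} (h₁ : Kato.IsKolyvaginPrime W p 1 ℓ₁) (h₂ : Kato.IsKolyvaginPrime W p 1 ℓ₂)
    (h₃ : Kato.IsKolyvaginPrime W p 1 ℓ₃) (h12 : ℓ₁ ≠ ℓ₂) (h13 : ℓ₁ ≠ ℓ₃) (h23 : ℓ₂ ≠ ℓ₃)
    (hn : ℓ₁ * ℓ₂ * ℓ₃ = n)
    (hcyc : ∀ (ℓ : ℕ) [Fact ℓ.Prime], ℓ ∣ n →
      Nat.card {P : ((WeierstrassCurve.integralModelInt W).map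
          (Int.castRingHom (ZMod ℓ))).toAffine.Point // p • P = 0} ≤ p) :
    IsCyclicKolyvaginLevel W p n := by
  refine ⟨⟨?_, fun ℓ hℓ ↦ ?_⟩, fun ℓ _ hℓ ↦ hcyc ℓ hℓ⟩
  · rw [← hn]
    refine Nat.squarefree_mul_iff.mpr ⟨Nat.Coprime.mul_left ((Nat.coprime_primes h₁.prime h₃.prime).mpr h13)
      ((Nat.coprime_primes h₂.prime h₃.prime).mpr h23), ?_, Irreducible.squarefree h₃.prime⟩
    exact Nat.squarefree_mul_iff.mpr ⟨(Nat.coprime_primes h₁.prime h₂.prime).mpr h12,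
      Irreducible.squarefree h₁.prime, Irreducible.squarefree h₂.prime⟩
  · rw [← hn] at hℓ
    obtain ⟨hℓ', hdvd, -⟩ := Nat.mem_primeFactors.mp hℓ
    rcases (Nat.Prime.dvd_mul hℓ').mp hdvd with hd | hd
    · rcases (Nat.Prime.dvd_mul hℓ').mp hd with hd' | hd'
      · rw [(Nat.prime_dvd_prime_iff_eq hℓ' h₁.prime).mp hd']; exact h₁
      · rw [(Nat.prime_dvd_prime_iff_eq hℓ' h₂.prime).mp hd']; exact h₂
    · rw [(Nat.prime_dvd_prime_iff_eq hℓ' h₃.prime).mp hd]; exact h₃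

end Summit.BirchSwinnertonDyer.BirchSwinnertonDyer.Theorems.KolyvaginDepthDoor

end
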